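import Mathlib
import HarnessLib
import Summits.HubbardSuperconductivity.HubbardSuperconductivity.Theorems.KLProgrammeKLRegimeSplitTwoLegSizesMSProfileSizes
import Summits.HubbardSuperconductivity.HubbardSuperconductivity.Theorems.KLProgrammePerturbedFermiCurveCompDiff
import Summits.HubbardSuperconductivity.HubbardSuperconductivity.Theorems.KLProgrammePerturbedFermiCurveHigherDerivsBand

/-!
# Route `KLProgramme`, crux K3 — gen-5 ENGINE child (stmt-…-19918, `stub_twoLeg_step`, clause `TwoLegSizesMST`), recipe (L)+(F):
# CENTRED ANGULAR SIZES OF A DIFFERENCE OF TWO CURVE PROFILES `F∘γ′ − F∘γ` ((P4-c), step 4b, generic part)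

Seat hubbard-kl-k3c3-p1 (g3).  For a symbol `F : V → ℝ` of class `C⁵` with GLOBAL sizes `‖Dᵏ F‖ ≤ M k` (`1 ≤ k ≤ 5`) and two `C⁴`
curves `γ, γ′ : ℝ → V` with common towers `‖γ⁽ⁱ⁾‖, ‖γ′⁽ⁱ⁾‖ ≤ D i` (`1 ≤ i ≤ 4`), distance `‖γ′ − γ‖ ≤ dD 0` and tower differences
`‖γ′⁽ⁱ⁾ − γ⁽ⁱ⁾‖ ≤ dD i`, the difference profile `q = F∘γ′ − F∘γ` has CENTRED angular sizes `‖Dⁱ(q − mean q)‖ ≤ bellDiffCum M D dD j`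
(`i ≤ j ≤ 4`), the cumulative sum of k3c3-p3's `abs_iteratedDeriv_{one…four}_comp_sub_le` right-hand sides with `Φ_k = M_{k+1}·dD₀`
(`norm_fderiv_{…}_sub_le_of_global`) and the order-zero entry `2·M₁·dD₀`.  This is the `hGs` input of `twoLegSizesMST_succ_of_chain_sizes`
for the deep slots `m ∈ Ioc (n+1) N` (profiles `msProfile … m = curveProfile μ S (msChain k) − curveProfile μ S (msChain (k−1))`).
Proofs only; nothing about the model.
-/

noncomputable section

namespace Summit.HubbardSuperconductivity.HubbardSuperconductivity.Theorems.KLRegimeSplit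

set_option linter.dupNamespace false -- summit = problem name (single-conjunct summit), D-0017
set_option maxSynthPendingDepth 4 -- nested operator-norm instances (up to fifth Fréchet derivatives), as in `…CompDiff`

open Real Finset Literature.MathematicalPhysics.QuantumLattice
open Summit.HubbardSuperconductivity.HubbardSuperconductivity.Theorems.PerturbedFermiCurve

/-- `‖D⁵f(p)‖ (nested) = ‖iteratedFDeriv 5 f p‖`. [folklore] -/
theorem norm_fderiv_five_eq_norm_iteratedFDeriv {V W : Type*} [NormedAddCommGroup V] [NormedSpace ℝ V] [NormedAddCommGroup W]
    [NormedSpace ℝ W] (f : V → W) (p : V) :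
    ‖fderiv ℝ (fderiv ℝ (fderiv ℝ (fderiv ℝ (fderiv ℝ f)))) p‖ = ‖iteratedFDeriv ℝ 5 f p‖ := by
  rw [norm_fderiv_four_eq_norm_iteratedFDeriv (fderiv ℝ f) p]
  exact norm_iteratedFDeriv_fderiv (𝕜 := ℝ) (f := f) (x := p) (n := 4)

/-- The two-curve Bell DIFFERENCE bound of order `i` (`Φ_k := M (k+1) · dD 0`; order `0 ↦ 2·M₁·dD₀`, the centred sup). -/
def bellDiffTerm (M D dD : ℕ → ℝ) : ℕ → ℝ
  | 0 => 2 * (M 1 * dD 0)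
  | 1 => M 2 * dD 0 * D 1 + M 1 * dD 1
  | 2 => M 3 * dD 0 * D 1 ^ 2 + 2 * M 2 * D 1 * dD 1 + M 2 * dD 0 * D 2 + M 1 * dD 2
  | 3 => M 4 * dD 0 * D 1 ^ 3 + 3 * M 3 * dD 1 * D 1 ^ 2 + 3 * (M 3 * dD 0 * D 1 * D 2 + M 2 * (dD 1 * D 2 + D 1 * dD 2)) +
      M 2 * dD 0 * D 3 + M 1 * dD 3
  | _ => M 5 * dD 0 * D 1 ^ 4 + 4 * M 4 * dD 1 * D 1 ^ 3 +
      6 * (M 4 * dD 0 * D 1 ^ 2 * D 2 + M 3 * (dD 2 * D 1 ^ 2 + 2 * D 1 * D 2 * dD 1)) +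
      3 * (M 3 * dD 0 * D 2 ^ 2 + 2 * M 2 * D 2 * dD 2) + 4 * (M 3 * dD 0 * D 1 * D 3 + M 2 * (dD 1 * D 3 + D 1 * dD 3)) +
      M 2 * dD 0 * D 4 + M 1 * dD 4

/-- The CUMULATIVE two-curve bound `Σ_{i ≤ j} bellDiffTerm i`. -/
def bellDiffCum (M D dD : ℕ → ℝ) (j : ℕ) : ℝ := ∑ i ∈ range (j + 1), bellDiffTerm M D dD i

/-- The difference terms are nonnegative for nonnegative data. -/
theorem bellDiffTerm_nonneg {M D dD : ℕ → ℝ} (hM : ∀ k, 0 ≤ M k) (hD : ∀ i, 0 ≤ D i) (hdD : ∀ i, 0 ≤ dD i) (i : ℕ) :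
    0 ≤ bellDiffTerm M D dD i := by
  have := hM 1; have := hM 2; have := hM 3; have := hM 4; have := hM 5
  have := hD 1; have := hD 2; have := hD 3; have := hD 4
  have := hdD 0; have := hdD 1; have := hdD 2; have := hdD 3; have := hdD 4
  rcases i with _ | _ | _ | _ | _ <;> simp only [bellDiffTerm] <;> positivity

/-- A single difference term is below the cumulative bound. -/
theorem bellDiffTerm_le_bellDiffCum {M D dD : ℕ → ℝ} (hM : ∀ k, 0 ≤ M k) (hD : ∀ i, 0 ≤ D i) (hdD : ∀ i, 0 ≤ dD i) {i j : ℕ}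
    (hij : i ≤ j) : bellDiffTerm M D dD i ≤ bellDiffCum M D dD j := by
  unfold bellDiffCum
  exact Finset.single_le_sum (fun k _ => bellDiffTerm_nonneg hM hD hdD k) (mem_range.mpr (by omega))

/-- **CENTRED ANGULAR SIZES OF A DIFFERENCE OF TWO CURVE PROFILES.**  See the module docstring. [folklore] -/
theorem comp_sub_centred_sizes {V : Type*} [NormedAddCommGroup V] [NormedSpace ℝ V] {F : V → ℝ} {γ γ' : ℝ → V}
    (hF : ContDiff ℝ 5 F) (hγ : ContDiff ℝ 4 γ) (hγ' : ContDiff ℝ 4 γ') {M D dD : ℕ → ℝ}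
    (hMnn : ∀ k, 0 ≤ M k) (hDnn : ∀ i, 0 ≤ D i) (hdDnn : ∀ i, 0 ≤ dD i)
    (hM : ∀ k, 1 ≤ k → k ≤ 5 → ∀ z, ‖iteratedFDeriv ℝ k F z‖ ≤ M k)
    (hD : ∀ i, 1 ≤ i → i ≤ 4 → ∀ θ, ‖iteratedDeriv i γ θ‖ ≤ D i) (hD' : ∀ i, 1 ≤ i → i ≤ 4 → ∀ θ, ‖iteratedDeriv i γ' θ‖ ≤ D i)
    (hdD0 : ∀ θ, ‖γ' θ - γ θ‖ ≤ dD 0)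
    (hdD : ∀ i, 1 ≤ i → i ≤ 4 → ∀ θ, ‖iteratedDeriv i γ' θ - iteratedDeriv i γ θ‖ ≤ dD i)
    {j : ℕ} (hj : j ≤ 4) {i : ℕ} (hi : i ≤ j) (t : ℝ) :
    ‖iteratedFDeriv ℝ i (fun t => (F (γ' t) - F (γ t)) - klAngularMean (fun t => F (γ' t) - F (γ t))) t‖ ≤
      bellDiffCum M D dD j := by
  refine le_trans ?_ (bellDiffTerm_le_bellDiffCum hMnn hDnn hdDnn hi)
  rw [norm_iteratedFDeriv_eq_norm_iteratedDeriv, Real.norm_eq_abs]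
  have hF4 : ContDiff ℝ 4 F := hF.of_le (by norm_num)
  -- nested global sizes of `F`
  have hM₁ : ∀ z, ‖fderiv ℝ F z‖ ≤ M 1 := fun z => by
    rw [norm_fderiv_eq_norm_iteratedFDeriv_one]; exact hM 1 le_rfl (by norm_num) z
  have hM₂ : ∀ z, ‖fderiv ℝ (fderiv ℝ F) z‖ ≤ M 2 := fun z => by
    rw [norm_fderiv_two_eq_norm_iteratedFDeriv]; exact hM 2 (by norm_num) (by norm_num) z
  have hM₃ : ∀ z, ‖fderiv ℝ (fderiv ℝ (fderiv ℝ F)) z‖ ≤ M 3 := fun z => by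
    rw [norm_fderiv_three_eq_norm_iteratedFDeriv]; exact hM 3 (by norm_num) (by norm_num) z
  have hM₄ : ∀ z, ‖fderiv ℝ (fderiv ℝ (fderiv ℝ (fderiv ℝ F))) z‖ ≤ M 4 := fun z => by
    rw [norm_fderiv_four_eq_norm_iteratedFDeriv]; exact hM 4 (by norm_num) (by norm_num) z
  have hM₅ : ∀ z, ‖fderiv ℝ (fderiv ℝ (fderiv ℝ (fderiv ℝ (fderiv ℝ F)))) z‖ ≤ M 5 := fun z => by
    rw [norm_fderiv_five_eq_norm_iteratedFDeriv]; exact hM 5 (by norm_num) (by norm_num) z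
  -- order zero of the difference: mean value
  have h0 : ∀ θ, |F (γ' θ) - F (γ θ)| ≤ M 1 * dD 0 := fun θ => by
    have h := (convex_univ).norm_image_sub_le_of_norm_fderiv_le (𝕜 := ℝ) (f := F)
      (fun z _ => (hF.differentiable (by norm_num)) z) (fun z _ => hM₁ z) (Set.mem_univ (γ θ)) (Set.mem_univ (γ' θ))
    rw [Real.norm_eq_abs] at h
    exact h.trans (mul_le_mul_of_nonneg_left (hdD0 θ) (hMnn 1))
  rcases Nat.eq_zero_or_pos i with rfl | hipos
  · simp only [iteratedDeriv_zero, bellDiffTerm]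
    calc |F (γ' t) - F (γ t) - klAngularMean fun t => F (γ' t) - F (γ t)|
        ≤ |F (γ' t) - F (γ t)| + |klAngularMean fun t => F (γ' t) - F (γ t)| := abs_sub _ _
      _ ≤ M 1 * dD 0 + M 1 * dD 0 := add_le_add (h0 t) (abs_klAngularMean_le' h0)
      _ = 2 * (M 1 * dD 0) := by ring
  · have e : (fun t => F (γ' t) - F (γ t) - klAngularMean fun t => F (γ' t) - F (γ t)) =
        fun t => -(klAngularMean fun t => F (γ' t) - F (γ t)) + ((F ∘ γ') - (F ∘ γ)) t := by
      funext t; simp only [Pi.sub_apply, Function.comp]; ring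
    have hi4 : i ≤ 4 := hi.trans hj
    have hc' : ContDiffAt ℝ i (F ∘ γ') t := ((hF4.comp hγ').of_le (by exact_mod_cast hi4)).contDiffAt
    have hc : ContDiffAt ℝ i (F ∘ γ) t := ((hF4.comp hγ).of_le (by exact_mod_cast hi4)).contDiffAt
    rw [e, iteratedDeriv_const_add hipos, iteratedDeriv_sub hc' hc]
    -- the `Φ_k`
    have hΦ₁ : ‖fderiv ℝ F (γ' t) - fderiv ℝ F (γ t)‖ ≤ M 2 * dD 0 :=
      (norm_fderiv_sub_le_of_global hF hM₂ _ _).trans (mul_le_mul_of_nonneg_left (hdD0 t) (hMnn 2))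
    have hΦ₂ : ‖fderiv ℝ (fderiv ℝ F) (γ' t) - fderiv ℝ (fderiv ℝ F) (γ t)‖ ≤ M 3 * dD 0 :=
      (norm_fderiv_two_sub_le_of_global hF hM₃ _ _).trans (mul_le_mul_of_nonneg_left (hdD0 t) (hMnn 3))
    have hΦ₃ : ‖fderiv ℝ (fderiv ℝ (fderiv ℝ F)) (γ' t) - fderiv ℝ (fderiv ℝ (fderiv ℝ F)) (γ t)‖ ≤ M 4 * dD 0 :=
      (norm_fderiv_three_sub_le_of_global hF hM₄ _ _).trans (mul_le_mul_of_nonneg_left (hdD0 t) (hMnn 4))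
    have hΦ₄ : ‖fderiv ℝ (fderiv ℝ (fderiv ℝ (fderiv ℝ F))) (γ' t) - fderiv ℝ (fderiv ℝ (fderiv ℝ (fderiv ℝ F))) (γ t)‖ ≤
        M 5 * dD 0 :=
      (norm_fderiv_four_sub_le_of_global hF hM₅ _ _).trans (mul_le_mul_of_nonneg_left (hdD0 t) (hMnn 5))
    have hD₁ := hD 1 le_rfl (by norm_num) t; have hD₂ := hD 2 (by norm_num) (by norm_num) t
    have hD₃ := hD 3 (by norm_num) (by norm_num) t
    have hD₁' := hD' 1 le_rfl (by norm_num) t; have hD₂' := hD' 2 (by norm_num) (by norm_num) t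
    have hD₃' := hD' 3 (by norm_num) (by norm_num) t; have hD₄' := hD' 4 (by norm_num) (by norm_num) t
    have hdD₁ := hdD 1 le_rfl (by norm_num) t; have hdD₂ := hdD 2 (by norm_num) (by norm_num) t
    have hdD₃ := hdD 3 (by norm_num) (by norm_num) t; have hdD₄ := hdD 4 (by norm_num) (by norm_num) t
    interval_cases i
    · simpa [bellDiffTerm] using abs_iteratedDeriv_one_comp_sub_le hF4 hγ hγ' (hM₁ _) hΦ₁ hD₁' hdD₁
    · have h := abs_iteratedDeriv_two_comp_sub_le hF4 hγ hγ' (hM₁ _) (hM₂ _) hΦ₁ hΦ₂ hD₁ hD₁' hD₂' hdD₁ hdD₂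
      simp only [bellDiffTerm]; linarith
    · have h := abs_iteratedDeriv_three_comp_sub_le hF4 hγ hγ' (hM₁ _) (hM₂ _) (hM₃ _) hΦ₁ hΦ₂ hΦ₃ hD₁ hD₁' hD₂ hD₂' hD₃'
        hdD₁ hdD₂ hdD₃
      simp only [bellDiffTerm]; linarith
    · have h := abs_iteratedDeriv_four_comp_sub_le hF4 hγ hγ' (hM₁ _) (hM₂ _) (hM₃ _) (hM₄ _) hΦ₁ hΦ₂ hΦ₃ hΦ₄ hD₁ hD₁' hD₂ hD₂'
        hD₃ hD₃' hD₄' hdD₁ hdD₂ hdD₃ hdD₄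
      simp only [bellDiffTerm]; linarith

end Summit.HubbardSuperconductivity.HubbardSuperconductivity.Theorems.KLRegimeSplit

end
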